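import Literature.NumberTheory.LFunctions.SiegelZeroFormSumAsymptoticTheoremTwoPosProofs
import Literature.NumberTheory.QuadraticFields.IdealClassEpsteinSum
import Literature.NumberTheory.QuadraticFields.IdealsOfPrimePowerNorm
import Literature.NumberTheory.QuadraticFields.RealQuadraticCycleIdentification
import Literature.NumberTheory.QuadraticFields.RealQuadraticRegulator
import Mathlib.NumberTheory.NumberField.ClassNumber
import HarnessLib

/-!
# Goldfeld–Schinzel 1975, §4 for `d > 0`: `Σ' 1/a ≤ h_K R_K / log(½√d − 1)` — the window forms of
# ONE ideal class contribute at most `R_K/log(½√d − 1)`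

Topic `Literature/NumberTheory/LFunctions` (namespace `Literature.NumberTheory.LFunctions`, auxiliary
lemmas in `GoldfeldSchinzel1975` as in the statement file `SiegelZeroFormSumAsymptotic.lean`). PROOF
LAYER (theorems only: no definitions, no named facts, debt 0) towards the EVEN (`d > 0`) half of
`goldfeldSchinzel1975_corollary` [GoldfeldSchinzel1975, Corollary p. 572, proof §4 pp. 582–583]
(cell `parity-realchar`, conditionals column I.17; cross-ladder literature-typing seat `littype-FP2-1`).

## The printed argument (p. 583) and the road taken here

p. 583: "For `d > 0` we have `L(1, χ) = h₀ log ε₀/√d` and we get from (19) and Theorem 2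
`1 − β ≥ (6/π²)(h₀ log ε₀/√d)(h₀ log ε₀/log(½√d − 1) + 4h₀/√d)⁻¹(1 − η/2) > (6/π² − η) log d/√d`",
where `h₀` is the number of proper classes of primitive forms of discriminant `d` and `ε₀` the least
totally positive unit, and Theorem 2 (`d > 676`) bounds the window sum `Σ_{f ∈ C} 1/|a|` of ONE proper
class `C` by `log ε₀/log(½√d − 1) + 4/√d`. What the deduction uses is only
**`Σ' 1/a ≤ (h₀ log ε₀)/log(½√d − 1) + O(h₀/√d)` together with `h₀ log ε₀ = 2 h_K R_K`**
(`L(1,χ) = 2h_K R_K/√d`, Dirichlet). The tree has the form side of Theorem 2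
(`goldfeldSchinzel1975_theorem2_pos_holds`, `SiegelZeroFormSumAsymptoticTheoremTwoPosProofs.lean`) but
no correspondence between proper classes of INDEFINITE forms and narrow ideal classes. We therefore
run the same unit-orbit argument of §3 directly on the IDEAL side, per WIDE ideal class and with the
fundamental unit `ε` (`log ε = R_K`) in place of `ε₀`:

* a window pair `(a, b)` (`−a < b ≤ a`, `16a² < d`, `4a ∣ b² − d`) gives the ideal
  `I_{(a,b)} = (a, ω − k)`, `k = (b + t)/2`, of norm `a` (the tree's form–ideal dictionary
  `Quadratic.mem_span_pair_iff_of_basis`, `Quadratic.absNorm_span_pair_eq`, Cox Thm. 7.7, for an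
  integral basis `(1, ω)`, `ω² = m + tω`, `d = d_K = t² + 4m`);
* fix a lattice ideal `𝔟 = (a₁, ω − k′)`; for the window pairs `f` with `I_f 𝔟` principal, a
  generator `z_f` with `λ_f = σ(z_f) ∈ [1, ε)` under the real embedding `σ` with `σ(2ω − t) = √d`
  exists and determines `f` (`exists_generator_mem_Ico`, the injectivity inside `sum_inv_le_of_class`);
* for two such generators `λ < μ` (of `f`, `g`): `a_f a₁ = |N z_f| = |λ λ′|`, and
  `λμ′ − λ′μ = √d · a₁ · κ` with `κ = r p′ − p r′ ∈ ℤ ∖ {0}` (`κ = 0` would make `z_f`, `z_g`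
  rationally proportional, hence — comparing the ideals `(ρ) I_g = (ρ′) I_f` through their elements of
  `ω`-coordinate `1` — equal up to sign: `ringHom_eq_of_wedge_zero`), so the tree's `separation` and
  `inv_le_log_div_log` (op. cit.) give `1/a_f ≤ (log μ − log λ)/log(½√d − 1)` (`pair_step`);
* the tree's abstract `chain_bound` then yields, per class,
  **`Σ_{f ∈ S} 1/a_f ≤ log ε / log(½√d − 1) = R_K/log(½√d − 1)`** (`sum_inv_le_of_class`), for any
  finite set `S` of window pairs whose ideals lie in one class (the class of `𝔟⁻¹`), `d > 676`.

Summing over the `h_K` classes (`SiegelZeroFormSumRegulatorBound` part 2, same file: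
`formSum_le_classNumber_mul_regulator_div`) gives `Σ' 1/a ≤ h_K R_K/log(½√d − 1)`, which is what §4
needs (without the `4h₀/√d`).

LABEL (cell rule): proof layer; 0 new definitions, 0 new facts; nothing here asserts that a Siegel
zero exists; nothing here bears on parity. No instances, no notation, standard axioms only.

## References

* [GoldfeldSchinzel1975] D. M. Goldfeld, A. Schinzel, *On Siegel's zero*, Ann. Scuola Norm. Sup. Pisa
  Cl. Sci. (4) 2 (1975) 571–583: Theorem 2 (pp. 571–572), §3 (pp. 577–582), §4 (pp. 582–583).
* [Cox2013] D. A. Cox, *Primes of the form x² + ny²*, 2nd ed., §7.B Thm. 7.7 (the ideal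
  `[a, (−b + √d)/2]`, `N = a`, `𝔞 𝔞̄ = (a)`).
* [NeukirchANT1999] J. Neukirch, *Algebraic Number Theory*, Ch. I §7 (Dirichlet's unit theorem,
  rank `1` for real quadratic fields), Ch. VII §5 (5.11) (class number formula).
-/

noncomputable section

open Module NumberField Ideal Finset
open Literature.NumberTheory.QuadraticFields Literature.NumberTheory.QuadraticFields.Quadratic

namespace Literature.NumberTheory.LFunctions

namespace GoldfeldSchinzel1975

variable {K : Type*} [Field K] [NumberField K]
variable (b : Basis (Fin 2) ℤ (𝓞 K)) (hb : b 0 = 1) {t m : ℤ}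
  (hω : b 1 * b 1 = (m : 𝓞 K) + (t : 𝓞 K) * b 1)

/-! ### Window pairs `(a, b)` and the lattice ideal `(a, ω − (b + t)/2)` -/

/-- Parity: `4a ∣ b² − d` with `d = t² + 4m` forces `b ≡ t (mod 2)`, so `k = (b + t)/2` is an
integer with `2k − t = b`. [cite: Cox2013, §7.B Thm. 7.7] -/
theorem two_mul_half_add_eq {D : ℕ} (hDt : (D : ℤ) = t ^ 2 + 4 * m) {a bb : ℤ}
    (hdiv : 4 * a ∣ bb ^ 2 - D) : 2 * ((bb + t) / 2) = bb + t := by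
  obtain ⟨c, hc⟩ := hdiv
  have h2 : 2 ∣ bb + t := by
    rcases Int.even_or_odd (bb + t) with he | ho
    · exact even_iff_two_dvd.mp he
    · exfalso
      have ho' : Odd (bb - t) := by
        obtain ⟨r, hr⟩ := ho
        exact ⟨r - t, by linarith⟩
      have hodd : Odd ((bb + t) * (bb - t)) := ho.mul ho'
      have heven : Even ((bb + t) * (bb - t)) := ⟨2 * (a * c + m), by linear_combination hc + hDt⟩
      exact (Int.not_even_iff_odd.mpr hodd) heven
  exact Int.mul_ediv_cancel' h2

/-- The norm datum of a window pair: with `k = (b + t)/2` and `c = (b² − d)/(4a)`,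
`a c = k² − tk − m` (i.e. `a ∣ N(ω − k)`) and `b² − 4ac = t² + 4m = d`.
[cite: Cox2013, §7.B Thm. 7.7] -/
theorem exists_norm_datum {D : ℕ} (hDt : (D : ℤ) = t ^ 2 + 4 * m) {a bb : ℤ}
    (hdiv : 4 * a ∣ bb ^ 2 - D) :
    ∃ c : ℤ, a * c = ((bb + t) / 2) ^ 2 - t * ((bb + t) / 2) - m ∧
      bb ^ 2 - 4 * a * c = t ^ 2 + 4 * m ∧ 2 * ((bb + t) / 2) - t = bb := by
  have hk := two_mul_half_add_eq hDt hdiv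
  obtain ⟨c, hc⟩ := hdiv
  set k := (bb + t) / 2 with hkdef
  refine ⟨c, ?_, by linear_combination hc + hDt, by linarith⟩
  have h4 : 4 * (a * c) = 4 * (k ^ 2 - t * k - m) := by
    linear_combination (-1 : ℤ) * hc + (-1 : ℤ) * hDt + (-(bb + 2 * k - t)) * hk
  exact mul_left_cancel₀ (by norm_num : (4 : ℤ) ≠ 0) h4

include hb hω in
/-- Forms of discriminant `d_K` are primitive: `gcd(a, 2k − t, c) = 1` for the norm datum of a
window pair (tree: `Quadratic.isUnit_of_dvd_of_disc_eq`). [cite: Cox2013, §7.B Thm. 7.7] -/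
theorem isUnit_of_dvd_window {a k c : ℤ} (hdisc : (2 * k - t) ^ 2 - 4 * a * c = t ^ 2 + 4 * m) :
    ∀ d : ℤ, d ∣ a → d ∣ 2 * k - t → d ∣ c → IsUnit d :=
  fun _ hdA hdB hdC => isUnit_of_dvd_of_disc_eq b hb hω hdisc hdA hdB hdC

/-! ### Lattice elements: coordinates, the real embedding, the norm -/

omit [NumberField K] in
include hb hω in
/-- An element of the lattice ideal `𝔟 = (a₁, ω − k′)` (`a₁ c₁ = k′² − tk′ − m`) is
`z = p a₁ + r(ω − k′) = (p a₁ − r k′) + r ω` with `p, r ∈ ℤ`. [cite: Cox2013, §7.B Thm. 7.7] -/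
theorem exists_coords_of_mem {a₁ k' c₁ : ℤ} (hn : a₁ * c₁ = k' ^ 2 - t * k' - m) {z : 𝓞 K}
    (hz : z ∈ span {(a₁ : 𝓞 K), b 1 - k'}) :
    ∃ p r : ℤ, z = ((p * a₁ - r * k' : ℤ) : 𝓞 K) + (r : 𝓞 K) * b 1 := by
  obtain ⟨p, r, h⟩ := (mem_span_pair_iff_of_basis b hb hω hn z).mp hz
  exact ⟨p, r, by rw [h]; push_cast; ring⟩

omit [NumberField K] in
/-- The real embedding of `x + yω` is `x + y σ(ω)`. [folklore] -/
private theorem ringHom_intCast_add_intCast_mul (σ : K →+* ℝ) (x y : ℤ) :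
    σ ((((x : 𝓞 K) + (y : 𝓞 K) * b 1 : 𝓞 K) : K)) = x + y * σ (b 1 : K) := by
  show σ (algebraMap (𝓞 K) K ((x : 𝓞 K) + (y : 𝓞 K) * b 1)) = _
  rw [map_add, map_mul, map_intCast, map_intCast, map_add, map_mul, map_intCast, map_intCast]

omit [NumberField K] in
include hω in
/-- `σ(ω)² = m + t σ(ω)`. [folklore] -/
private theorem ringHom_omega_sq (σ : K →+* ℝ) :
    σ (b 1 : K) ^ 2 = m + t * σ (b 1 : K) := by
  have h := congrArg (fun x : 𝓞 K => σ ((x : 𝓞 K) : K)) hω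
  have e1 : σ (((b 1 * b 1 : 𝓞 K)) : K) = σ (b 1 : K) ^ 2 := by
    show σ (algebraMap (𝓞 K) K (b 1 * b 1)) = _
    rw [map_mul, map_mul, sq]
  have e2 : σ ((((m : 𝓞 K) + (t : 𝓞 K) * b 1 : 𝓞 K)) : K) = m + t * σ (b 1 : K) :=
    ringHom_intCast_add_intCast_mul b σ m t
  rw [e1, e2] at h
  exact h

omit [NumberField K] in
include hb hω in
/-- **Norm versus embeddings**: for `z = x + yω`, `N(z) = σ(z) · (x + y(t − σ(ω)))` (the second
factor is the conjugate embedding `σ′(z)`, `σ′(ω) = t − σ(ω)`). [cite: Cox2013, §7.A (norm form)] -/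
theorem norm_eq_ringHom_mul_conj (σ : K →+* ℝ) (x y : ℤ) :
    ((Algebra.norm ℤ ((x : 𝓞 K) + (y : 𝓞 K) * b 1) : ℤ) : ℝ) =
      σ ((((x : 𝓞 K) + (y : 𝓞 K) * b 1 : 𝓞 K) : K)) * (x + y * (t - σ (b 1 : K))) := by
  rw [norm_intCast_add_intCast_mul b hb hω, ringHom_intCast_add_intCast_mul b σ]
  have hs := ringHom_omega_sq b hω σ
  push_cast
  linear_combination ((y : ℝ) ^ 2) * hs

/-- **The cross term**: for `z = (p a₁ − r k′) + rω`, `w = (p′ a₁ − r′ k′) + r′ω` and `s = σ(ω)`,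
`λμ′ − λ′μ = (2s − t) · a₁ · (r p′ − p r′)` where `λ = z₀ + r s`, `λ′ = z₀ + r(t − s)` etc.
(the printed `λμ′ − λ′μ = (√d/α)(p₁r₂ − p₂r₁)`). [cite: GoldfeldSchinzel1975, §3 pp. 578–580] -/
theorem cross_term (s : ℝ) (t a₁ k' p r p' r' : ℤ) :
    ((p * a₁ - r * k' : ℤ) + r * s) * ((p' * a₁ - r' * k' : ℤ) + r' * (t - s)) -
      ((p * a₁ - r * k' : ℤ) + r * (t - s)) * ((p' * a₁ - r' * k' : ℤ) + r' * s) =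
      (2 * s - t) * a₁ * ((r * p' - p * r' : ℤ) : ℝ) := by
  push_cast
  ring

/-! ### The norm of a generator of `I_f 𝔟` -/

include hb hω in
/-- If `(z) = (a, ω − k) · (a₁, ω − k′)` with norm data for both lattice ideals, then
`|N(z)| = |a| · |a₁|`. [cite: Cox2013, §7.B Thm. 7.7 (N(a, (−b+√d)/2) = a)] -/
theorem natAbs_norm_of_span_eq_mul {a k c a₁ k' c₁ : ℤ} (hn : a * c = k ^ 2 - t * k - m)
    (hn₁ : a₁ * c₁ = k' ^ 2 - t * k' - m) {z : 𝓞 K}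
    (hz : span {z} = span {(a : 𝓞 K), b 1 - k} * span {(a₁ : 𝓞 K), b 1 - k'}) :
    (Algebra.norm ℤ z).natAbs = a.natAbs * a₁.natAbs := by
  have h := congrArg Ideal.absNorm hz
  rw [Ideal.absNorm_span_singleton, map_mul, absNorm_span_pair_eq b hb hω hn,
    absNorm_span_pair_eq b hb hω hn₁] at h
  exact h


/-! ### Two window pairs with the same lattice ideal are equal -/

include hb hω in
/-- **Window injectivity**: if two window pairs `(a, b)`, `(a′, b′)` (`−a < b ≤ a`) give the same
lattice ideal `(a, ω − (b + t)/2) = (a′, ω − (b′ + t)/2)`, they are equal: the norms give `a = a′`,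
and `ω − k′ ∈ (a, ω − k)` gives `a ∣ k − k′ = (b − b′)/2` with `|b − b′| < 2a`.
[cite: Cox2013, §7.B Thm. 7.7] -/
theorem eq_of_span_pair_eq {D : ℕ} (hDt : (D : ℤ) = t ^ 2 + 4 * m) {af ag : ℕ} {bf bg : ℤ}
    (hbf1 : -(af : ℤ) < bf) (hbf2 : bf ≤ af) (hdf : 4 * (af : ℤ) ∣ bf ^ 2 - D)
    (hbg1 : -(ag : ℤ) < bg) (hbg2 : bg ≤ ag) (hdg : 4 * (ag : ℤ) ∣ bg ^ 2 - D)
    (h : span {((af : ℤ) : 𝓞 K), b 1 - (((bf + t) / 2 : ℤ) : 𝓞 K)} =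
      span {((ag : ℤ) : 𝓞 K), b 1 - (((bg + t) / 2 : ℤ) : 𝓞 K)}) : af = ag ∧ bf = bg := by
  obtain ⟨cf, hnf, -, hkf⟩ := exists_norm_datum hDt hdf
  obtain ⟨cg, hng, -, hkg⟩ := exists_norm_datum hDt hdg
  have hN := congrArg Ideal.absNorm h
  rw [absNorm_span_pair_eq b hb hω hnf, absNorm_span_pair_eq b hb hω hng, Int.natAbs_natCast,
    Int.natAbs_natCast] at hN
  subst hN
  refine ⟨rfl, ?_⟩
  set kf := (bf + t) / 2 with hkfdef
  set kg := (bg + t) / 2 with hkgdef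
  have hmem : ((kf - kg : ℤ) : 𝓞 K) ∈ span {((af : ℤ) : 𝓞 K), b 1 - (kf : 𝓞 K)} := by
    have h1 : b 1 - (kg : 𝓞 K) ∈ span {((af : ℤ) : 𝓞 K), b 1 - (kf : 𝓞 K)} := by
      rw [h]; exact Ideal.subset_span (by simp)
    have h2 : b 1 - (kf : 𝓞 K) ∈ span {((af : ℤ) : 𝓞 K), b 1 - (kf : 𝓞 K)} :=
      Ideal.subset_span (by simp)
    have e : ((kf - kg : ℤ) : 𝓞 K) = (b 1 - (kg : 𝓞 K)) - (b 1 - (kf : 𝓞 K)) := by push_cast; ring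
    rw [e]
    exact Ideal.sub_mem _ h1 h2
  rw [intCast_mem_span_pair_iff b hb hω hnf] at hmem
  have hlt : |kf - kg| < (af : ℤ) := by
    rw [abs_lt]; constructor <;> omega
  have h0 := Int.eq_zero_of_abs_lt_dvd hmem hlt
  omega

/-! ### Rationally proportional generators are equal up to sign -/

include hb in
/-- If `(z) = I_f 𝔟`, `(w) = I_g 𝔟` for lattice ideals `I_f = (a, ω − k)`, `I_g = (a′, ω − k″)`,
`𝔟 = (a₁, ω − k′) ≠ 0`, and `c w = c′ z` with integers `c ≠ 0`, `c′`, then `w = ±z`: reducing to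
coprime `(ρ, ρ′)` and cancelling `𝔟`, `(ρ) I_g = (ρ′) I_f`; the element `ρ(ω − k″)` of the left side
has `ω`-coordinate `ρ`, every element of `(ρ′)` has `ω`-coordinate divisible by `ρ′`, so `ρ′ ∣ ρ`,
symmetrically `ρ ∣ ρ′`, hence `ρ, ρ′ = ±1`. [cite: Cox2013, §7.B Thm. 7.7] -/
theorem eq_or_eq_neg_of_intCast_mul_eq {a k a' k'' a₁ k' : ℤ} (ha₁ : a₁ ≠ 0) {z w : 𝓞 K}
    (hz : span {z} = span {(a : 𝓞 K), b 1 - k} * span {(a₁ : 𝓞 K), b 1 - k'})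
    (hw : span {w} = span {(a' : 𝓞 K), b 1 - k''} * span {(a₁ : 𝓞 K), b 1 - k'})
    {c c' : ℤ} (hc : c ≠ 0) (hrel : (c : 𝓞 K) * w = (c' : 𝓞 K) * z) :
    w = z ∨ w = -z := by
  -- reduce to a coprime pair `(ρ, ρ')`
  have hg : 0 < Int.gcd c c' := Int.gcd_pos_of_ne_zero_left _ hc
  obtain ⟨g, ρ, ρ', hg0, hcop, hcg, hc'g⟩ := Int.exists_gcd_one' hg
  have hρ0 : ρ ≠ 0 := by
    rintro rfl
    rw [zero_mul] at hcg
    exact hc hcg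
  have hrel' : (ρ : 𝓞 K) * w = (ρ' : 𝓞 K) * z := by
    have hgK : ((g : ℤ) : 𝓞 K) ≠ 0 := by exact_mod_cast (by omega : (g : ℤ) ≠ 0)
    apply mul_left_cancel₀ hgK
    have h1 : (c : 𝓞 K) * w = (c' : 𝓞 K) * z := hrel
    rw [hcg, hc'g] at h1
    push_cast at h1 ⊢
    linear_combination h1
  set If : Ideal (𝓞 K) := span {(a : 𝓞 K), b 1 - k} with hIf
  set Ig : Ideal (𝓞 K) := span {(a' : 𝓞 K), b 1 - k''} with hIg
  set B : Ideal (𝓞 K) := span {(a₁ : 𝓞 K), b 1 - k'} with hB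
  have hB0 : B ≠ 0 := by
    intro h0
    rw [Submodule.zero_eq_bot, hB, Ideal.span_eq_bot] at h0
    exact ha₁ (by exact_mod_cast h0 (a₁ : 𝓞 K) (by simp))
  have hideal : span {(ρ : 𝓞 K)} * Ig = span {(ρ' : 𝓞 K)} * If := by
    apply mul_right_cancel₀ hB0
    rw [mul_assoc, mul_assoc, ← hw, ← hz, Ideal.span_singleton_mul_span_singleton,
      Ideal.span_singleton_mul_span_singleton, hrel']
  -- `ω`-coordinates: `ρ' ∣ ρ` and `ρ ∣ ρ'`
  have hcoord : ∀ (ρ ρ' kk : ℤ) (J : Ideal (𝓞 K)),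
      (ρ : 𝓞 K) * (b 1 - kk) ∈ span {(ρ' : 𝓞 K)} * J → ρ' ∣ ρ := by
    intro ρ ρ' kk J hmem
    obtain ⟨y, -, hy⟩ := Ideal.mem_span_singleton_mul.mp hmem
    have e1 : b.repr ((ρ : 𝓞 K) * (b 1 - kk)) 1 = ρ := by
      have : (ρ : 𝓞 K) * (b 1 - kk) = ((-(ρ * kk) : ℤ) : 𝓞 K) + (ρ : 𝓞 K) * b 1 := by
        push_cast; ring
      rw [this, repr_intCast_add_intCast_mul_one b hb]
    have e2 : b.repr ((ρ' : 𝓞 K) * y) 1 = ρ' * b.repr y 1 := by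
      rw [show ((ρ' : 𝓞 K) * y) = (ρ' : ℤ) • y from (zsmul_eq_mul _ _).symm, LinearEquiv.map_smul,
        Finsupp.smul_apply, smul_eq_mul]
    rw [hy, e1] at e2
    exact ⟨b.repr y 1, e2⟩
  have hdvd1 : ρ' ∣ ρ := by
    refine hcoord ρ ρ' k'' If ?_
    rw [← hideal]
    exact Ideal.mul_mem_mul (Ideal.mem_span_singleton_self _) (Ideal.subset_span (by simp))
  have hdvd2 : ρ ∣ ρ' := by
    refine hcoord ρ' ρ k Ig ?_
    rw [hideal]
    exact Ideal.mul_mem_mul (Ideal.mem_span_singleton_self _) (Ideal.subset_span (by simp))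
  have hcop' : IsCoprime ρ ρ' := Int.isCoprime_iff_gcd_eq_one.mpr hcop
  have hu' : IsUnit ρ' := hcop'.isUnit_of_dvd' hdvd1 (dvd_refl _)
  have hu : IsUnit ρ := hcop'.isUnit_of_dvd' (dvd_refl _) hdvd2
  rcases Int.isUnit_iff.mp hu with h1 | h1 <;> rcases Int.isUnit_iff.mp hu' with h2 | h2 <;>
    rw [h1, h2] at hrel' <;> push_cast at hrel'
  · left; linear_combination hrel'
  · right; linear_combination hrel'
  · right; linear_combination -hrel'
  · left; linear_combination -hrel'

/-! ### The pair step: `1/a_f · log(½√d − 1) ≤ log μ − log λ` -/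

include hb hω in
/-- **The pair step** (ideal-side form of [GoldfeldSchinzel1975, §3 pp. 578–582]): let
`𝔟 = (a₁, ω − k′)` (`a₁ > 0`, `a₁c₁ = k′² − tk′ − m`), let `f = (a_f, b_f)`, `g = (a_g, b_g)` be
window pairs (`16a² < d`, `4a ∣ b² − d`, `a_f ≥ 1`) and `z`, `w` generators of `I_f 𝔟`, `I_g 𝔟` with
`0 < λ = σ(z) < μ = σ(w)` under the real embedding with `σ(2ω − t) = √d`, `d > 676`. Then
`(1/a_f) log(½√d − 1) ≤ log μ − log λ`. (`|N z| = a_f a₁ = |λλ′|`, `λμ′ − λ′μ = √d a₁ κ` with a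
non-zero integer `κ`, then `separation` and `inv_le_log_div_log`.)
[cite: GoldfeldSchinzel1975, Theorem 2 pp. 571–572, §3 (12)–(18) pp. 578–582] -/
theorem pair_step {D : ℕ} (hDt : (D : ℤ) = t ^ 2 + 4 * m) (hD676 : 676 < D) (σ : K →+* ℝ)
    (hσ : 2 * σ (b 1 : K) - t = Real.sqrt D) {a₁ k' c₁ : ℤ} (ha₁ : 0 < a₁)
    (hn₁ : a₁ * c₁ = k' ^ 2 - t * k' - m) {af ag : ℕ} {bf bg : ℤ} (haf : 1 ≤ af)
    (haf' : 16 * af ^ 2 < D) (hdf : 4 * (af : ℤ) ∣ bf ^ 2 - D) (hag' : 16 * ag ^ 2 < D)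
    (hdg : 4 * (ag : ℤ) ∣ bg ^ 2 - D) {z w : 𝓞 K}
    (hz : span {z} = span {((af : ℤ) : 𝓞 K), b 1 - (((bf + t) / 2 : ℤ) : 𝓞 K)} *
      span {(a₁ : 𝓞 K), b 1 - k'})
    (hw : span {w} = span {((ag : ℤ) : 𝓞 K), b 1 - (((bg + t) / 2 : ℤ) : 𝓞 K)} *
      span {(a₁ : 𝓞 K), b 1 - k'})
    (hpos : 0 < σ (z : K)) (hlt : σ (z : K) < σ (w : K)) :
    1 / (af : ℝ) * Real.log (Real.sqrt D / 2 - 1) ≤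
      Real.log (σ (w : K)) - Real.log (σ (z : K)) := by
  obtain ⟨cf, hnf, -, -⟩ := exists_norm_datum hDt hdf
  obtain ⟨cg, hng, -, -⟩ := exists_norm_datum hDt hdg
  have hμpos : 0 < σ (w : K) := hpos.trans hlt
  -- coordinates in `𝔟`
  have hzB : z ∈ span {(a₁ : 𝓞 K), b 1 - k'} := by
    have h1 : z ∈ span {z} := Ideal.mem_span_singleton_self z
    rw [hz] at h1
    exact Ideal.mul_le_left h1
  have hwB : w ∈ span {(a₁ : 𝓞 K), b 1 - k'} := by
    have h1 : w ∈ span {w} := Ideal.mem_span_singleton_self w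
    rw [hw] at h1
    exact Ideal.mul_le_left h1
  obtain ⟨p, r, hzc⟩ := exists_coords_of_mem b hb hω hn₁ hzB
  obtain ⟨p', r', hwc⟩ := exists_coords_of_mem b hb hω hn₁ hwB
  set s : ℝ := σ (b 1 : K) with hsdef
  -- the embeddings `λ, μ` and the conjugates `λ', μ'`
  have hlam : σ (z : K) = ((p * a₁ - r * k' : ℤ) : ℝ) + r * s := by
    rw [hzc]; exact ringHom_intCast_add_intCast_mul b σ _ _
  have hμ : σ (w : K) = ((p' * a₁ - r' * k' : ℤ) : ℝ) + r' * s := by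
    rw [hwc]; exact ringHom_intCast_add_intCast_mul b σ _ _
  set lam : ℝ := σ (z : K) with hlamdef
  set μ : ℝ := σ (w : K) with hμdef
  set lam' : ℝ := ((p * a₁ - r * k' : ℤ) : ℝ) + r * (t - s) with hlam'def
  set μ' : ℝ := ((p' * a₁ - r' * k' : ℤ) : ℝ) + r' * (t - s) with hμ'def
  -- norms
  have hNz : ((Algebra.norm ℤ z : ℤ) : ℝ) = lam * lam' := by
    have e := norm_eq_ringHom_mul_conj b hb hω σ (p * a₁ - r * k') r
    rw [← hzc] at e
    exact e
  have hNw : ((Algebra.norm ℤ w : ℤ) : ℝ) = μ * μ' := by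
    have e := norm_eq_ringHom_mul_conj b hb hω σ (p' * a₁ - r' * k') r'
    rw [← hwc] at e
    exact e
  have ha₁R : (0 : ℝ) < a₁ := by exact_mod_cast ha₁
  have hNz_abs : |((Algebra.norm ℤ z : ℤ) : ℝ)| = af * a₁ := by
    have e := natAbs_norm_of_span_eq_mul b hb hω hnf hn₁ hz
    rw [Int.natAbs_natCast] at e
    have e' : |Algebra.norm ℤ z| = (af : ℤ) * a₁ := by
      rw [Int.abs_eq_natAbs, e]; push_cast; rw [abs_of_pos ha₁]
    exact_mod_cast e'
  have hNw_abs : |((Algebra.norm ℤ w : ℤ) : ℝ)| = ag * a₁ := by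
    have e := natAbs_norm_of_span_eq_mul b hb hω hng hn₁ hw
    rw [Int.natAbs_natCast] at e
    have e' : |Algebra.norm ℤ w| = (ag : ℤ) * a₁ := by
      rw [Int.abs_eq_natAbs, e]; push_cast; rw [abs_of_pos ha₁]
    exact_mod_cast e'
  -- the cross term and `κ ≠ 0`
  set κ : ℤ := r * p' - p * r' with hκdef
  have hcross : lam * μ' - lam' * μ = Real.sqrt D * a₁ * (κ : ℝ) := by
    rw [hlam, hμ, hlam'def, hμ'def, cross_term, hσ]
  have hκ : κ ≠ 0 := by
    intro hκ0
    -- then `z, w` are rationally proportional, hence `w = ±z`, contradicting `λ < μ`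
    have hprop : ∃ c c' : ℤ, c ≠ 0 ∧ (c : 𝓞 K) * w = (c' : 𝓞 K) * z := by
      by_cases hr : r = 0
      · have hp : p ≠ 0 := by
          rintro rfl
          rw [hr] at hzc
          have h0 : z = 0 := by rw [hzc]; push_cast; ring
          rw [hlamdef, h0] at hpos
          simp at hpos
        have hr' : r' = 0 := by
          have h0 : p * r' = 0 := by rw [hκdef, hr] at hκ0; linarith
          rcases mul_eq_zero.mp h0 with h | h
          · exact absurd h hp
          · exact h
        refine ⟨p, p', hp, ?_⟩
        rw [hzc, hwc, hr, hr']
        push_cast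
        ring
      · refine ⟨r, r', hr, ?_⟩
        have hκK : ((r * p' - p * r' : ℤ) : 𝓞 K) = 0 := by
          rw [← hκdef, hκ0]; push_cast; rfl
        rw [hzc, hwc]
        push_cast at hκK ⊢
        linear_combination (a₁ : 𝓞 K) * hκK
    obtain ⟨c, c', hc, hrel⟩ := hprop
    rcases eq_or_eq_neg_of_intCast_mul_eq b hb ha₁.ne' hz hw hc hrel with h | h
    · rw [hμdef, h] at hlt
      exact lt_irrefl _ hlt
    · have h0 : μ = -lam := by
        rw [hμdef, hlamdef, h]
        show σ (algebraMap (𝓞 K) K (-z)) = -σ (algebraMap (𝓞 K) K z)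
        rw [map_neg, map_neg]
      linarith
  have hκ1 : (1 : ℝ) ≤ |(κ : ℝ)| := by exact_mod_cast Int.one_le_abs hκ
  -- separation
  have hsD : (26 : ℝ) < Real.sqrt D := by
    rw [show (26 : ℝ) = Real.sqrt (26 ^ 2) by rw [Real.sqrt_sq]; norm_num]
    exact Real.sqrt_lt_sqrt (by norm_num) (by exact_mod_cast (by omega : 26 ^ 2 < D))
  have hsD0 : 0 < Real.sqrt D := by linarith
  have hsep := separation (α := 1 / (a₁ : ℝ)) (sD := Real.sqrt D) (lam := lam) (lam' := lam')
    (μ := μ) (μ' := μ') (fa := ((Algebra.norm ℤ z : ℤ) : ℝ) / a₁)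
    (ga := ((Algebra.norm ℤ w : ℤ) : ℝ) / a₁) (k := (κ : ℝ)) (by positivity) hsD0 hpos hμpos
    (by rw [hNz]; field_simp) (by rw [hNw]; field_simp) (by rw [hcross]; field_simp) hκ1
  rw [abs_div, abs_div, hNz_abs, hNw_abs, abs_of_pos ha₁R, mul_div_cancel_right₀ _ ha₁R.ne',
    mul_div_cancel_right₀ _ ha₁R.ne'] at hsep
  -- the per-term lemma
  have hafR : (1 : ℝ) ≤ af := by exact_mod_cast haf
  have h4af : 4 * (af : ℝ) ≤ Real.sqrt D := by
    have h : (4 * (af : ℝ)) ^ 2 < D := by exact_mod_cast (by nlinarith : (4 * af) ^ 2 < D)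
    exact ((Real.lt_sqrt (by positivity)).mpr h).le
  have h4ag : 4 * (ag : ℝ) ≤ Real.sqrt D := by
    have h : (4 * (ag : ℝ)) ^ 2 < D := by exact_mod_cast (by nlinarith : (4 * ag) ^ 2 < D)
    exact ((Real.lt_sqrt (by positivity)).mpr h).le
  have hx : 1 < μ / lam := (one_lt_div hpos).mpr hlt
  have hper := inv_le_log_div_log hsD hafR h4af (by positivity) h4ag hx hsep
  have hL : 0 < Real.log (Real.sqrt D / 2 - 1) := Real.log_pos (by linarith)
  rw [Real.log_div hμpos.ne' hpos.ne'] at hper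
  rwa [← le_div_iff₀ hL]

/-! ### A unit with `σ(u) = ε` and generators in `[1, ε)` -/

omit [NumberField K] in
include hω in
/-- **A unit of `𝓞 K` whose embedding is the fundamental unit `ε = (G + B√d)/2` of
`RealQuadraticPrincipalCycle`** (`G² − dB² = ±4`; the unit is `(G − tB)/2 + Bω`).
[cite: NeukirchANT1999, Ch. I §7 (units of real quadratic fields)] -/
theorem exists_unit_ringHom_eq_fundUnit {D : ℕ} (hDt : (D : ℤ) = t ^ 2 + 4 * m)
    (hD : ¬ IsSquare D) (hD4 : D % 4 = 0 ∨ D % 4 = 1) (σ : K →+* ℝ)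
    (hσ : 2 * σ (b 1 : K) - t = Real.sqrt D) :
    ∃ u : (𝓞 K)ˣ, σ ((u : 𝓞 K) : K) = QuadIrr.fundUnit D := by
  obtain ⟨G, B, -, -, hGB, hε, -⟩ := QuadIrr.exists_fundUnit_eq hD hD4
  have hGt : 2 ∣ G - t * B := by
    refine QuadIrr.two_dvd_sub_mul (D := D) ⟨(t ^ 2 - t) / 2 + 2 * m, ?_⟩ ?_
    · have := QuadIrr.two_dvd_sq_sub_self t
      rw [hDt]; omega
    · rcases hGB with h | h <;> rw [h] <;> norm_num
  have hGB' : G ^ 2 - (t ^ 2 + 4 * m) * B ^ 2 = 4 ∨ G ^ 2 - (t ^ 2 + 4 * m) * B ^ 2 = -4 := by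
    rwa [← hDt]
  have key : ∀ u : (𝓞 K)ˣ, (u : 𝓞 K) = (((G - t * B) / 2 : ℤ) : 𝓞 K) + (B : 𝓞 K) * b 1 →
      σ ((u : 𝓞 K) : K) = QuadIrr.fundUnit D := by
    intro u hu
    rw [hu, ringHom_intCast_add_mul b σ hGt, hσ, hε]
  rcases hGB' with hpos | hneg
  · exact ⟨unitOfSolPos b hω hGt hpos, key _ rfl⟩
  · exact ⟨unitOfSolNeg b hω hGt hneg, key _ rfl⟩

omit [NumberField K] in
/-- Powers of a unit under a real embedding: `σ(uⁿ) = σ(u)ⁿ` (`n ∈ ℤ`). [folklore] -/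
private theorem ringHom_units_zpow (σ : K →+* ℝ) (u : (𝓞 K)ˣ) (n : ℤ) :
    σ (((u ^ n : (𝓞 K)ˣ) : 𝓞 K) : K) = σ ((u : 𝓞 K) : K) ^ n := by
  set ψ : (𝓞 K)ˣ →* ℝˣ := Units.map ((σ : K →* ℝ).comp (algebraMap (𝓞 K) K : 𝓞 K →* K))
    with hψ
  have h1 : ∀ v : (𝓞 K)ˣ, ((ψ v : ℝˣ) : ℝ) = σ ((v : 𝓞 K) : K) := fun v => rfl
  rw [← h1, map_zpow, Units.val_zpow_eq_zpow_val, h1]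

omit [NumberField K] in
/-- **Generators in the fundamental strip**: a non-zero principal ideal `(z₀)` has a generator `z`
with `σ(z) ∈ [1, E)`, `E = σ(u) > 1` for a unit `u` (replace `z₀` by `±u⁻ⁿ z₀`).
[cite: GoldfeldSchinzel1975, §3 (13) p. 578] -/
theorem exists_generator_mem_Ico (σ : K →+* ℝ) {E : ℝ} (hE : 1 < E) (u : (𝓞 K)ˣ)
    (hu : σ ((u : 𝓞 K) : K) = E) {I : Ideal (𝓞 K)} {z₀ : 𝓞 K} (hz₀ : z₀ ≠ 0)
    (hI : span {z₀} = I) :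
    ∃ z : 𝓞 K, span {z} = I ∧ 1 ≤ σ (z : K) ∧ σ (z : K) < E := by
  -- a generator with positive embedding
  obtain ⟨z₁, hz₁I, hz₁pos⟩ : ∃ z₁ : 𝓞 K, span {z₁} = I ∧ 0 < σ (z₁ : K) := by
    have hne : σ ((z₀ : 𝓞 K) : K) ≠ 0 := by
      show σ (algebraMap (𝓞 K) K z₀) ≠ 0
      rw [map_ne_zero]
      exact RingOfIntegers.coe_ne_zero_iff.mpr hz₀
    rcases lt_or_gt_of_ne hne with hneg | hpos
    · refine ⟨-z₀, by rw [Ideal.span_singleton_neg, hI], ?_⟩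
      have e : σ (((-z₀ : 𝓞 K)) : K) = -σ ((z₀ : 𝓞 K) : K) := by
        show σ (algebraMap (𝓞 K) K (-z₀)) = -σ (algebraMap (𝓞 K) K z₀)
        rw [map_neg, map_neg]
      rw [e]
      exact neg_pos.mpr hneg
    · exact ⟨z₀, hI, hpos⟩
  have hE0 : 0 < E := by linarith
  obtain ⟨n, hn1, hn2⟩ := exists_mem_Ico_zpow hz₁pos hE
  have e : σ (((((u ^ (-n) : (𝓞 K)ˣ) : 𝓞 K) * z₁ : 𝓞 K)) : K) = E ^ (-n) * σ (z₁ : K) := by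
    show σ (algebraMap (𝓞 K) K (((u ^ (-n) : (𝓞 K)ˣ) : 𝓞 K) * z₁)) = _
    rw [map_mul, map_mul]
    show σ (((u ^ (-n) : (𝓞 K)ˣ) : 𝓞 K) : K) * σ (z₁ : K) = _
    rw [ringHom_units_zpow, hu]
  refine ⟨((u ^ (-n) : (𝓞 K)ˣ) : 𝓞 K) * z₁, ?_, ?_, ?_⟩
  · rw [Ideal.span_singleton_mul_left_unit (Units.isUnit _), hz₁I]
  · rw [e, zpow_neg, ← div_eq_inv_mul, le_div_iff₀ (zpow_pos hE0 n), one_mul]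
    exact hn1
  · rw [e, zpow_neg, ← div_eq_inv_mul, div_lt_iff₀ (zpow_pos hE0 n), mul_comm,
      ← zpow_add_one₀ hE0.ne']
    exact hn2

/-! ### The per-class bound -/

include hb hω in
/-- **Goldfeld–Schinzel's Theorem 2 (`d > 676`) on the ideal side, per (wide) ideal class.** Let `K`
be a real quadratic field with integral basis `(1, ω)`, `ω² = m + tω`, `d = d_K = t² + 4m > 676`,
`ε = ε(d)` its fundamental unit (`log ε = R_K`), and `𝔟 = (a₁, ω − k′)` a lattice ideal. For every
finite set `S` of window pairs `(a, b)` (`1 ≤ a`, `16a² < d`, `−a < b ≤ a`, `4a ∣ b² − d`) whose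
ideals `(a, ω − (b + t)/2)` all lie in the class of `𝔟⁻¹` (i.e. `I_f 𝔟` principal),
`Σ_{f ∈ S} 1/a_f ≤ log ε / log(½√d − 1)`. (The printed bound, per proper class of forms and with
the least totally positive unit, is `log ε₀/log(½√d − 1) + 4/√d`.)
[cite: GoldfeldSchinzel1975, Theorem 2 pp. 571–572, §3 pp. 577–582] -/
theorem sum_inv_le_of_class {D : ℕ} (hDt : (D : ℤ) = t ^ 2 + 4 * m) (h2 : finrank ℚ K = 2)
    (hd : 0 < NumberField.discr K) (hdisc : NumberField.discr K = D) (hD676 : 676 < D)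
    {a₁ k' c₁ : ℤ} (ha₁ : 0 < a₁) (hn₁ : a₁ * c₁ = k' ^ 2 - t * k' - m) (S : Finset (ℕ × ℤ))
    (hwin : ∀ f ∈ S, 1 ≤ f.1 ∧ 16 * f.1 ^ 2 < D ∧ -(f.1 : ℤ) < f.2 ∧ f.2 ≤ f.1 ∧
      4 * (f.1 : ℤ) ∣ f.2 ^ 2 - D)
    (hgen : ∀ f ∈ S, ∃ z : 𝓞 K, z ≠ 0 ∧
      span {z} = span {((f.1 : ℤ) : 𝓞 K), b 1 - (((f.2 + t) / 2 : ℤ) : 𝓞 K)} *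
        span {(a₁ : 𝓞 K), b 1 - k'}) :
    ∑ f ∈ S, (1 : ℝ) / f.1 ≤ Real.log (QuadIrr.fundUnit D) / Real.log (Real.sqrt D / 2 - 1) := by
  classical
  have hDnsq : ¬ IsSquare D := by
    have h := not_isSquare_discr_toNat h2 hd
    rwa [hdisc, Int.toNat_natCast] at h
  have hD4 : D % 4 = 0 ∨ D % 4 = 1 := by
    have h := discr_toNat_mod_four h2 hd
    rwa [hdisc, Int.toNat_natCast] at h
  set E : ℝ := QuadIrr.fundUnit D with hEdef
  have hE : 1 < E := QuadIrr.one_lt_fundUnit hDnsq hD4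
  have hE0 : 0 < E := by linarith
  obtain ⟨σ, hσ⟩ := exists_ringHom_sqrt b hb hω h2 hd hDt
  obtain ⟨u, hu⟩ := exists_unit_ringHom_eq_fundUnit b hω hDt hDnsq hD4 σ hσ
  set B : Ideal (𝓞 K) := span {(a₁ : 𝓞 K), b 1 - k'} with hBdef
  have hB0 : B ≠ 0 := by
    intro h0
    rw [Submodule.zero_eq_bot, hBdef, Ideal.span_eq_bot] at h0
    exact ha₁.ne' (by exact_mod_cast h0 (a₁ : 𝓞 K) (by simp))
  set I : ℕ × ℤ → Ideal (𝓞 K) := fun f =>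
    span {((f.1 : ℤ) : 𝓞 K), b 1 - (((f.2 + t) / 2 : ℤ) : 𝓞 K)} with hIdef
  set Good : ℕ × ℤ → ℝ → Prop := fun f lam =>
    0 < lam ∧ ∃ z : 𝓞 K, span {z} = I f * B ∧ σ (z : K) = lam with hGood
  have hrep : ∀ f ∈ S, ∃ lam : ℝ, Good f lam ∧ 1 ≤ lam ∧ lam < E := by
    intro f hf
    obtain ⟨z₀, hz₀, hz₀I⟩ := hgen f hf
    obtain ⟨z, hzI, h1, h2'⟩ := exists_generator_mem_Ico σ hE u hu hz₀ hz₀I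
    exact ⟨σ (z : K), ⟨by linarith, z, hzI, rfl⟩, h1, h2'⟩
  choose! ℓ hℓgood hℓ1 hℓE using hrep
  set L : ℝ := Real.log (Real.sqrt D / 2 - 1) with hLdef
  have hsD : (26 : ℝ) < Real.sqrt D := by
    rw [show (26 : ℝ) = Real.sqrt (26 ^ 2) by rw [Real.sqrt_sq]; norm_num]
    exact Real.sqrt_lt_sqrt (by norm_num) (by exact_mod_cast (by omega : 26 ^ 2 < D))
  have hL : 0 < L := Real.log_pos (by linarith)
  have key := chain_bound S (fun f : ℕ × ℤ => (1 : ℝ) / f.1) ℓ Good (E := E) (L := L) hE hℓgood hℓ1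
    hℓE ?_ ?_ ?_
  · rwa [le_div_iff₀ hL]
  · -- injectivity: equal representatives ⇒ equal generators ⇒ equal ideals ⇒ equal pairs
    intro f hf g hg hfg
    obtain ⟨-, z, hz, hzl⟩ := hℓgood f hf
    obtain ⟨-, w, hw, hwl⟩ := hℓgood g hg
    have hzw : z = w := by
      have h1 : σ (z : K) = σ (w : K) := by rw [hzl, hwl, hfg]
      exact RingOfIntegers.coe_injective (σ.injective h1)
    have hI : I f = I g := by
      apply mul_right_cancel₀ hB0
      rw [← hz, ← hw, hzw]
    obtain ⟨_, _, hbf1, hbf2, hdf⟩ := hwin f hf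
    obtain ⟨_, _, hbg1, hbg2, hdg⟩ := hwin g hg
    obtain ⟨ha, hbb⟩ := eq_of_span_pair_eq b hb hω hDt hbf1 hbf2 hdf hbg1 hbg2 hdg hI
    exact Prod.ext ha hbb
  · -- closure under multiplication by `E = σ(u)`
    rintro g - μ ⟨hμ, w, hw, hwμ⟩
    refine ⟨by positivity, (u : 𝓞 K) * w,
      by rw [Ideal.span_singleton_mul_left_unit u.isUnit, hw], ?_⟩
    show σ (algebraMap (𝓞 K) K ((u : 𝓞 K) * w)) = _
    rw [map_mul, map_mul, ← hwμ, hEdef, ← hu]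
  · -- the pair step
    rintro f hf g hg lam μ ⟨hlam, z, hz, hzl⟩ ⟨hμ, w, hw, hwμ⟩ hlt
    obtain ⟨haf, haf', -, -, hdf⟩ := hwin f hf
    obtain ⟨-, hag', -, -, hdg⟩ := hwin g hg
    subst hzl hwμ
    exact pair_step b hb hω hDt hD676 σ hσ ha₁ hn₁ haf haf' hdf hag' hdg hz hw hlam hlt

/-! ### Summing over the ideal classes: `Σ' 1/a ≤ h_K R_K / log(½√d − 1)` -/

/-- `Σ' 1/a` (`SiegelZeroFormSumAsymptotic.formSum`) for `d = D > 0` as a sum of `1/a` over the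
finite set of window pairs `(a, b)`, `1 ≤ a`, `16a² < D`, `−a < b ≤ a`, `4a ∣ b² − D`.
[cite: GoldfeldSchinzel1975, Theorem 1 (1)–(2) p. 571] -/
theorem formSum_natCast_eq_sum_pairs (D : ℕ) :
    formSum (D : ℤ) = ∑ f ∈ ((Icc 1 D) ×ˢ (Ioc (-(D : ℤ)) D)).filter (fun f : ℕ × ℤ =>
      16 * f.1 ^ 2 < D ∧ -(f.1 : ℤ) < f.2 ∧ f.2 ≤ f.1 ∧ 4 * (f.1 : ℤ) ∣ f.2 ^ 2 - D),
      (1 : ℝ) / f.1 := by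
  classical
  rw [Finset.sum_finset_product _ ((Icc 1 D).filter (fun a => 16 * a ^ 2 < D))
    (fun a => (Ioc (-(a : ℤ)) a).filter (fun bb => 4 * (a : ℤ) ∣ bb ^ 2 - D))]
  · rw [formSum, Int.natAbs_natCast]
    refine Finset.sum_congr rfl fun a _ => ?_
    dsimp only
    rw [pairCount, Finset.sum_const, nsmul_eq_mul, mul_one_div]
  · rintro ⟨a, bb⟩
    simp only [Finset.mem_filter, Finset.mem_product, Finset.mem_Icc, Finset.mem_Ioc]
    constructor
    · rintro ⟨⟨⟨ha1, haD⟩, -, -⟩, h16, hb3, hb4, hdvd⟩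
      exact ⟨⟨⟨ha1, haD⟩, h16⟩, ⟨hb3, hb4⟩, hdvd⟩
    · rintro ⟨⟨⟨ha1, haD⟩, h16⟩, ⟨hb3, hb4⟩, hdvd⟩
      refine ⟨⟨⟨ha1, haD⟩, ?_, ?_⟩, h16, hb3, hb4, hdvd⟩ <;> omega

/-- **`Σ' 1/a ≤ h_K R_K / log(½√d − 1)` for a real quadratic field `K` with `d = d_K > 676`.**
The window pairs are distributed into the `h_K` ideal classes of their lattice ideals
`(a, ω − (b + t)/2)`; in the class of `𝔟⁻¹`, `𝔟 = (a₁, ω − (t − k₁))` the conjugate of the ideal of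
any member `(a₁, b₁)` (`I 𝔟 = (a₁)`, Cox Thm. 7.7), every `I_f 𝔟` is principal and
`sum_inv_le_of_class` bounds the class sum by `log ε/log(½√d − 1) = R_K/log(½√d − 1)`
(`Quadratic.regulator_eq_log_fundUnit'`). This is the `d > 0` input
`Σ' 1/a ≤ h₀ (log ε₀/log(½√d − 1) + 4/√d)`, `h₀ log ε₀ = 2h_K R_K`, of the printed deduction, in the
sharper wide-class form. [cite: GoldfeldSchinzel1975, Theorem 2 pp. 571–572 and §4 p. 583]
[cite: Cox2013, §7.B Thm. 7.7] -/
theorem formSum_le_classNumber_mul_regulator_div (K : Type*) [Field K] [NumberField K]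
    (h2 : finrank ℚ K = 2) {D : ℕ} (hdisc : NumberField.discr K = D) (hD676 : 676 < D) :
    formSum (D : ℤ) ≤
      classNumber K * NumberField.Units.regulator K / Real.log (Real.sqrt D / 2 - 1) := by
  classical
  obtain ⟨b, hb⟩ := exists_basis_zero_eq_one (K := K) h2
  set t : ℤ := b.repr (b 1 * b 1) 1 with ht
  set m : ℤ := b.repr (b 1 * b 1) 0 with hm
  have hω := basis_one_mul_self_eq b hb
  rw [← ht, ← hm] at hω
  have hdisc' : NumberField.discr K = t ^ 2 + 4 * m := by rw [discr_eq_sq_add_four_mul b hb]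
  have hDt : (D : ℤ) = t ^ 2 + 4 * m := by rw [← hdisc, hdisc']
  have hD0 : 0 < D := by omega
  have hd : 0 < NumberField.discr K := by rw [hdisc]; exact_mod_cast hD0
  have hDnsq : ¬ IsSquare D := by
    have h := not_isSquare_discr_toNat h2 hd
    rwa [hdisc, Int.toNat_natCast] at h
  have hD4 : D % 4 = 0 ∨ D % 4 = 1 := by
    have h := discr_toNat_mod_four h2 hd
    rwa [hdisc, Int.toNat_natCast] at h
  have hE : 1 < QuadIrr.fundUnit D := QuadIrr.one_lt_fundUnit hDnsq hD4
  have hreg : NumberField.Units.regulator K = Real.log (QuadIrr.fundUnit D) := by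
    rw [regulator_eq_log_fundUnit' h2 hd, hdisc, Int.toNat_natCast]
  set L : ℝ := Real.log (Real.sqrt D / 2 - 1) with hLdef
  have hsD : (26 : ℝ) < Real.sqrt D := by
    rw [show (26 : ℝ) = Real.sqrt (26 ^ 2) by rw [Real.sqrt_sq]; norm_num]
    exact Real.sqrt_lt_sqrt (by norm_num) (by exact_mod_cast (by omega : 26 ^ 2 < D))
  have hL : 0 < L := Real.log_pos (by linarith)
  -- the window pairs
  set W : Finset (ℕ × ℤ) := ((Icc 1 D) ×ˢ (Ioc (-(D : ℤ)) D)).filter (fun f : ℕ × ℤ =>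
      16 * f.1 ^ 2 < D ∧ -(f.1 : ℤ) < f.2 ∧ f.2 ≤ f.1 ∧ 4 * (f.1 : ℤ) ∣ f.2 ^ 2 - D) with hW
  rw [formSum_natCast_eq_sum_pairs D]
  have hwinW : ∀ f ∈ W, 1 ≤ f.1 ∧ 16 * f.1 ^ 2 < D ∧ -(f.1 : ℤ) < f.2 ∧ f.2 ≤ f.1 ∧
      4 * (f.1 : ℤ) ∣ f.2 ^ 2 - D := by
    intro f hf
    rw [hW, Finset.mem_filter, Finset.mem_product, Finset.mem_Icc] at hf
    exact ⟨hf.1.1.1, hf.2⟩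
  -- the lattice ideals and their classes
  set I : ℕ × ℤ → Ideal (𝓞 K) := fun f =>
    span {((f.1 : ℤ) : 𝓞 K), b 1 - (((f.2 + t) / 2 : ℤ) : 𝓞 K)} with hI
  have hI0 : ∀ f, I f ≠ 0 := by
    intro f h0
    have hmem : b 1 - (((f.2 + t) / 2 : ℤ) : 𝓞 K) ∈ I f := Ideal.subset_span (by simp)
    rw [h0, Submodule.zero_eq_bot, Ideal.mem_bot] at hmem
    have hrepr := repr_intCast_add_intCast_mul_one b hb (-((f.2 + t) / 2)) 1
    have e : ((-((f.2 + t) / 2) : ℤ) : 𝓞 K) + ((1 : ℤ) : 𝓞 K) * b 1 =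
        b 1 - (((f.2 + t) / 2 : ℤ) : 𝓞 K) := by push_cast; ring
    rw [e, hmem, map_zero, Finsupp.zero_apply] at hrepr
    exact zero_ne_one hrepr
  set cls : ℕ × ℤ → ClassGroup (𝓞 K) := fun f =>
    ClassGroup.mk0 ⟨I f, mem_nonZeroDivisors_iff_ne_zero.mpr (hI0 f)⟩ with hcls
  rw [← Finset.sum_fiberwise_of_maps_to (s := W) (t := Finset.univ) (g := cls)
    (fun _ _ => Finset.mem_univ _)]
  have hcard : (Finset.univ : Finset (ClassGroup (𝓞 K))).card = classNumber K := by
    rw [Finset.card_univ]; rfl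
  -- the per-class bound
  have hclass : ∀ c : ClassGroup (𝓞 K),
      ∑ f ∈ W.filter (fun f => cls f = c), (1 : ℝ) / f.1 ≤ Real.log (QuadIrr.fundUnit D) / L := by
    intro c
    by_cases hne : (W.filter fun f => cls f = c).Nonempty
    · obtain ⟨f₁, hf₁⟩ := hne
      obtain ⟨hf₁W, hc₁⟩ := Finset.mem_filter.mp hf₁
      obtain ⟨ha₁, -, -, -, hdvd₁⟩ := hwinW f₁ hf₁W
      obtain ⟨c₁, hn₁, hdisc₁, hk₁⟩ := exists_norm_datum hDt hdvd₁
      have ha₁Z : (0 : ℤ) < (f₁.1 : ℤ) := by exact_mod_cast ha₁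
      have hn₁' := norm_eq_conj hn₁
      have hprim : ∀ d : ℤ, d ∣ (f₁.1 : ℤ) → d ∣ 2 * ((f₁.2 + t) / 2) - t → d ∣ c₁ → IsUnit d :=
        isUnit_of_dvd_window b hb hω (by rw [hk₁]; linear_combination hdisc₁)
      have hconj : I f₁ * span {((f₁.1 : ℤ) : 𝓞 K), b 1 - ((t - (f₁.2 + t) / 2 : ℤ) : 𝓞 K)} =
          span {((f₁.1 : ℤ) : 𝓞 K)} := span_pair_mul_span_pair_conj b hω hn₁ hprim
      set B : Ideal (𝓞 K) := span {((f₁.1 : ℤ) : 𝓞 K), b 1 - ((t - (f₁.2 + t) / 2 : ℤ) : 𝓞 K)}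
        with hBdef
      have hB0 : B ≠ 0 := by
        intro h0
        rw [hBdef, Submodule.zero_eq_bot, Ideal.span_eq_bot] at h0
        exact ha₁Z.ne' (by exact_mod_cast h0 ((f₁.1 : ℤ) : 𝓞 K) (by simp))
      refine sum_inv_le_of_class b hb hω hDt h2 hd hdisc hD676 ha₁Z hn₁' _
        (fun f hf => hwinW f (Finset.mem_filter.mp hf).1) ?_
      intro f hf
      obtain ⟨-, hcf⟩ := Finset.mem_filter.mp hf
      have hIB : I f * B ∈ nonZeroDivisors (Ideal (𝓞 K)) :=
        mem_nonZeroDivisors_iff_ne_zero.mpr (mul_ne_zero (hI0 f) hB0)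
      have key : ClassGroup.mk0 ⟨I f * B, hIB⟩ = 1 := by
        have e1 : (⟨I f * B, hIB⟩ : nonZeroDivisors (Ideal (𝓞 K))) =
            ⟨I f, mem_nonZeroDivisors_iff_ne_zero.mpr (hI0 f)⟩ *
              ⟨B, mem_nonZeroDivisors_iff_ne_zero.mpr hB0⟩ := rfl
        have e2 : ClassGroup.mk0 ⟨I f, mem_nonZeroDivisors_iff_ne_zero.mpr (hI0 f)⟩ =
            ClassGroup.mk0 ⟨I f₁, mem_nonZeroDivisors_iff_ne_zero.mpr (hI0 f₁)⟩ := by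
          have h1 : cls f = cls f₁ := by rw [hcf, hc₁]
          simpa only [hcls] using h1
        have e3 : (⟨I f₁, mem_nonZeroDivisors_iff_ne_zero.mpr (hI0 f₁)⟩ : nonZeroDivisors (Ideal (𝓞 K))) *
            ⟨B, mem_nonZeroDivisors_iff_ne_zero.mpr hB0⟩ =
              ⟨I f₁ * B, mem_nonZeroDivisors_iff_ne_zero.mpr (mul_ne_zero (hI0 f₁) hB0)⟩ := rfl
        rw [e1, map_mul, e2, ← map_mul, e3, ClassGroup.mk0_eq_one_iff]
        show (I f₁ * B).IsPrincipal
        rw [hconj]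
        exact ⟨⟨((f₁.1 : ℤ) : 𝓞 K), rfl⟩⟩
      have hP : (I f * B).IsPrincipal := (ClassGroup.mk0_eq_one_iff hIB).mp key
      obtain ⟨z, hz⟩ := hP.principal
      have hz' : span {z} = I f * B := by rw [hz]
      refine ⟨z, ?_, hz'⟩
      intro hz0
      rw [hz0] at hz'
      exact mul_ne_zero (hI0 f) hB0 (by rw [← hz']; simp)
    · rw [Finset.not_nonempty_iff_eq_empty.mp hne, Finset.sum_empty]
      exact div_nonneg (Real.log_nonneg hE.le) hL.le
  calc ∑ c ∈ (Finset.univ : Finset (ClassGroup (𝓞 K))), ∑ f ∈ W.filter (fun f => cls f = c),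
        (1 : ℝ) / f.1
      ≤ ∑ c ∈ (Finset.univ : Finset (ClassGroup (𝓞 K))), Real.log (QuadIrr.fundUnit D) / L :=
        Finset.sum_le_sum fun c _ => hclass c
    _ = classNumber K * NumberField.Units.regulator K / L := by
        rw [Finset.sum_const, nsmul_eq_mul, hcard, hreg]; ring

end GoldfeldSchinzel1975

end Literature.NumberTheory.LFunctions

end
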